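import Summits.QuantumFields.YangMills.Theorems.AllWindowsColdBoxBoxHighLineEdgeChartParity
import Summits.QuantumFields.YangMills.Theorems.AllWindowsColdBoxBoxHighLineEdgeChartMoments
import Summits.QuantumFields.YangMills.Theorems.AllWindowsColdBoxBoxHighLinePlaquetteObsL2ByName
import Summits.QuantumFields.YangMills.Theorems.AllWindowsColdBoxBoxHighLinePlaquetteEdgeMoments
import Summits.QuantumFields.YangMills.Theorems.AllWindowsColdBoxBoxHighLineBoxStateEdgeChart
import Mathlib.Algebra.QuadraticDiscriminant

/-!
# T-S5.13m — the GAUSSIAN FULL-COST REDUCTION (ASSEMBLY-S5 §6 (e3), second half):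
# `|Cov₀(c₀, c_T) − Cov₀(|ℓ₀|², |ℓ_T|²)| ≤ C/β³` for the full chart plaquette costs, `β ≥ 1`, `H ≥ 1`

Planner ym-idea-2 g18's `ASSEMBLY-S5.md` §6 (e3): «`Cov₀(c₀,c_T) = Cov₀(linCurvSq₀, linCurvSq_T) + [Cov₀(linCurvSq₀, c_T^{odd}) + (0↔T) = 0 by parity] + R₀,
|R₀| ≤ … ≤ Cβ⁻³`».  With `c = L + O + R` (`L = linCurvSq`, `O = chartPlaqCostOdd`, `R` = the even remainder), PARITY (✓`…EdgeChartParity`: `L`, `R` even, `O` odd, so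
`E₀[L·O′] = E₀[R·O′] = E₀[O] = 0`) gives EXACTLY

  `Cov₀(c,c′) − Cov₀(L,L′) = Cov₀(L,R′) + Cov₀(R,L′) + E₀[O·O′] + Cov₀(R,R′)`,

and Cauchy–Schwarz in `L²(gaussAvg)` with the sizes of ✓T-S5.12d `plaquetteObsL2` (`E₀L² ≤ C/β²`, `E₀O² ≤ C/β³`, `E₀R² ≤ C/β⁴`) bounds it by `7C/β³`.

* §1 measurability / integrability of the chart costs against `gaussWeight` (✓`measurable_edgeChart`, ✓`continuous_plaqCostAt`; majorants in `S = Σ_i‖v_i‖²`,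
  ✓`PlaqObsL2.integrable_edgeSq_pow_mul_gaussWeight`);
* §2 Cauchy–Schwarz for `gaussAvg` (`abs_gaussAvg_mul_le_sqrt`, `abs_gaussAvg_le_sqrt`, `abs_gaussCov_le`) via the discriminant;
* §3 ★★`gaussCov_chartPlaqCost_sub_linCurvSq_le` — the reduction, constant `7·C_{12d}`.

Tree (✓EdgeChartParity, ✓EdgeChartMoments, ✓PlaquetteObsL2ByName (w5 g22 / w2 g31), ✓PlaquetteEdgeMoments, ✓BoxStateEdgeChart) + Mathlib; no definitions.
HONEST LABEL: one (e3) ingredient of the T-S5.13 assembly of the XL stub S5 of a critic-PASSed DRAFT line; T-S5.13/S5, U5, ⟨24004⟩ ⟨24335⟩ ⟨24336⟩ remain OPEN; route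
AllWindowsColdBox is DRAFT; no rung is proved; the Yang–Mills mass gap is NOT proved by this file.  Seat ym-line-sfw-p2 g77 (LEAD, cell ym-idea-1; T-S5.13 assembler of record).
-/

set_option autoImplicit false

noncomputable section

open MeasureTheory Matrix Finset
open Literature.Probability.LatticeModels (Site)
open Summit.QuantumFields.YangMills.Theorems.WeakCouplingRates (plaq12At)

namespace Summit.QuantumFields.YangMills.Theorems.AllWindowsColdBoxBoxHighLine

namespace EdgeChartGaussian

variable {H : ℕ}

/-! ## §1 Measurability and integrability of the chart costs -/

/-- The chart plaquette cost is measurable in the edge field. -/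
theorem measurable_chartPlaqCost (H : ℕ) (x : Site 4) (μ ν : Fin 4) : Measurable (chartPlaqCost H x μ ν) :=
  (Summit.QuantumFields.YangMills.Theorems.WeakCouplingRates.continuous_plaqCostAt x μ ν).measurable.comp (EdgeChart.measurable_edgeChart H)

/-- Its odd part is measurable. -/
theorem measurable_chartPlaqCostOdd (H : ℕ) (x : Site 4) (μ ν : Fin 4) : Measurable (chartPlaqCostOdd H x μ ν) := by
  unfold chartPlaqCostOdd
  exact ((measurable_chartPlaqCost H x μ ν).sub ((measurable_chartPlaqCost H x μ ν).comp measurable_neg)).div_const 2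

/-- `|ℓ_p|²` is measurable. -/
theorem measurable_linCurvSq (H : ℕ) (p : Literature.MathematicalPhysics.QuantumFieldTheory.Plaq 4) : Measurable (linCurvSq H p) := by
  unfold linCurvSq linCurv
  refine Finset.measurable_sum _ fun c _ => Measurable.pow_const ?_ 2
  simp only [dotProduct, colour]
  exact Finset.measurable_sum _ fun e _ => (measurable_coord e c).const_mul _

/-- Integrability by domination: a measurable `F` with `|F| ≤ G` and `G·gaussWeight` integrable has `F·gaussWeight` integrable. -/
theorem integrable_mul_gaussWeight_of_abs_le (H : ℕ) {β : ℝ} (hβ : 0 < β) {F G : (LandauFree H → E3) → ℝ} (hFm : Measurable F)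
    (hG : Integrable (fun a => G a * gaussWeight β H a)) (hle : ∀ a, |F a| ≤ G a) :
    Integrable (fun a : LandauFree H → E3 => F a * gaussWeight β H a) := by
  refine hG.mono' (hFm.aestronglyMeasurable.mul (aestronglyMeasurable_gaussWeight H hβ)) (Filter.Eventually.of_forall fun a => ?_)
  rw [Real.norm_eq_abs, abs_mul, abs_of_pos (gaussWeight_pos β H a)]
  exact mul_le_mul_of_nonneg_right (hle a) (gaussWeight_pos β H a).le

/-- `0 ≤ |ℓ_p|² ≤ 4·S_p`, `S_p = Σ_i ‖v_i‖²`. -/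
theorem linCurvSq_le_edgeSq (H : ℕ) (x : Site 4) (a : LandauFree H → E3) :
    0 ≤ linCurvSq H (plaq12At x) a ∧ linCurvSq H (plaq12At x) a ≤ 4 * ∑ i : Fin 4, ‖plaqVar H x 1 2 a i‖ ^ 2 := by
  have h := PlaqObsL2.linCurvSq_eq_norm_plaqLin_sq H x 1 2 a
  rw [show plaq12At x = (x, 1, 2) from rfl, h]
  exact ⟨sq_nonneg _, PlaqObsL2.norm_plaqLin_sq_le _⟩

/-! ## §2 Cauchy–Schwarz for `gaussAvg` -/

/-- `gaussAvg` of a constant. -/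
theorem gaussAvg_const_fun (H : ℕ) {β : ℝ} (hβ : 0 < β) (c : ℝ) : gaussAvg β H (fun _ => c) = c := by
  unfold gaussAvg
  rw [integral_const_mul, mul_div_assoc, div_self (integral_gaussWeight_pos H hβ).ne', mul_one]

/-- ★ **Cauchy–Schwarz**: `|E₀[FG]| ≤ √E₀[F²]·√E₀[G²]` (via the discriminant of `t ↦ E₀[(tF+G)²] ≥ 0`). -/
theorem abs_gaussAvg_mul_le_sqrt (H : ℕ) {β : ℝ} (hβ : 0 < β) {F G : (LandauFree H → E3) → ℝ}
    (hF2 : Integrable (fun a => F a ^ 2 * gaussWeight β H a)) (hG2 : Integrable (fun a => G a ^ 2 * gaussWeight β H a))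
    (hFG : Integrable (fun a => F a * G a * gaussWeight β H a)) :
    |gaussAvg β H (fun a => F a * G a)| ≤ Real.sqrt (gaussAvg β H (fun a => F a ^ 2)) * Real.sqrt (gaussAvg β H (fun a => G a ^ 2)) := by
  set A := gaussAvg β H (fun a => F a ^ 2) with hA
  set B := gaussAvg β H (fun a => F a * G a) with hB
  set Cg := gaussAvg β H (fun a => G a ^ 2) with hCg
  have hA0 : 0 ≤ A := gaussAvg_nonneg H hβ fun a => sq_nonneg _
  have hquad : ∀ t : ℝ, 0 ≤ A * (t * t) + 2 * B * t + Cg := by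
    intro t
    have hpos : 0 ≤ gaussAvg β H (fun a => (t * F a + G a) ^ 2) := gaussAvg_nonneg H hβ fun a => sq_nonneg _
    have hsplit : (fun a : LandauFree H → E3 => (t * F a + G a) ^ 2) = fun a => (t ^ 2 * F a ^ 2 + 2 * t * (F a * G a)) + G a ^ 2 := by
      funext a; ring
    have hI1 : Integrable (fun a : LandauFree H → E3 => t ^ 2 * F a ^ 2 * gaussWeight β H a) :=
      (hF2.const_mul (t ^ 2)).congr (Filter.Eventually.of_forall fun a => by ring)
    have hI2 : Integrable (fun a : LandauFree H → E3 => 2 * t * (F a * G a) * gaussWeight β H a) :=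
      (hFG.const_mul (2 * t)).congr (Filter.Eventually.of_forall fun a => by ring)
    have hI12 : Integrable (fun a : LandauFree H → E3 => (t ^ 2 * F a ^ 2 + 2 * t * (F a * G a)) * gaussWeight β H a) :=
      (hI1.add hI2).congr (Filter.Eventually.of_forall fun a => by simp only [Pi.add_apply]; ring)
    rw [hsplit, gaussAvg_add _ _ hI12 hG2, gaussAvg_add _ _ hI1 hI2, gaussAvg_const_mul, gaussAvg_const_mul] at hpos
    rw [hA, hB, hCg]
    nlinarith [hpos]
  have hdisc := discrim_le_zero hquad
  rw [discrim] at hdisc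
  have hB2 : B ^ 2 ≤ A * Cg := by nlinarith [hdisc]
  calc |B| ≤ Real.sqrt (A * Cg) := Real.abs_le_sqrt hB2
    _ = Real.sqrt A * Real.sqrt Cg := Real.sqrt_mul hA0 Cg

/-- `|E₀[F]| ≤ √E₀[F²]`. -/
theorem abs_gaussAvg_le_sqrt (H : ℕ) {β : ℝ} (hβ : 0 < β) {F : (LandauFree H → E3) → ℝ}
    (hF2 : Integrable (fun a => F a ^ 2 * gaussWeight β H a)) (hF : Integrable (fun a => F a * gaussWeight β H a)) :
    |gaussAvg β H F| ≤ Real.sqrt (gaussAvg β H (fun a => F a ^ 2)) := by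
  have h1 : Integrable (fun a : LandauFree H → E3 => (1 : ℝ) ^ 2 * gaussWeight β H a) :=
    (integrable_gaussWeight H hβ).congr (Filter.Eventually.of_forall fun a => by ring)
  have hF1 : Integrable (fun a : LandauFree H → E3 => F a * 1 * gaussWeight β H a) := hF.congr (Filter.Eventually.of_forall fun a => by ring)
  have h := abs_gaussAvg_mul_le_sqrt H hβ hF2 h1 hF1
  have hone : gaussAvg β H (fun _ : LandauFree H → E3 => (1 : ℝ) ^ 2) = 1 := by rw [one_pow]; exact gaussAvg_const_fun H hβ 1
  rw [hone, Real.sqrt_one, mul_one] at h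
  have hFF : gaussAvg β H (fun a => F a * 1) = gaussAvg β H F := by simp only [mul_one]
  rwa [hFF] at h

/-- ★ `|Cov₀(F,G)| ≤ 2·√E₀[F²]·√E₀[G²]`. -/
theorem abs_gaussCov_le (H : ℕ) {β : ℝ} (hβ : 0 < β) {F G : (LandauFree H → E3) → ℝ}
    (hF : Integrable (fun a => F a * gaussWeight β H a)) (hG : Integrable (fun a => G a * gaussWeight β H a))
    (hF2 : Integrable (fun a => F a ^ 2 * gaussWeight β H a)) (hG2 : Integrable (fun a => G a ^ 2 * gaussWeight β H a))
    (hFG : Integrable (fun a => F a * G a * gaussWeight β H a)) :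
    |gaussCov β H F G| ≤ 2 * (Real.sqrt (gaussAvg β H (fun a => F a ^ 2)) * Real.sqrt (gaussAvg β H (fun a => G a ^ 2))) := by
  unfold gaussCov
  have h1 := abs_gaussAvg_mul_le_sqrt H hβ hF2 hG2 hFG
  have h2 := abs_gaussAvg_le_sqrt H hβ hF2 hF
  have h3 := abs_gaussAvg_le_sqrt H hβ hG2 hG
  calc |gaussAvg β H (fun a => F a * G a) - gaussAvg β H F * gaussAvg β H G|
      ≤ |gaussAvg β H (fun a => F a * G a)| + |gaussAvg β H F * gaussAvg β H G| := abs_sub _ _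
    _ ≤ _ := by
        rw [abs_mul]
        nlinarith [mul_le_mul h2 h3 (abs_nonneg _) (Real.sqrt_nonneg _), Real.sqrt_nonneg (gaussAvg β H (fun a => F a ^ 2)),
          Real.sqrt_nonneg (gaussAvg β H (fun a => G a ^ 2))]

/-! ## §3 The reduction -/

/-- ★★ **T-S5.13m — Gaussian full-cost reduction.**  There is `C` (`= 7·C_{12d}`) such that for all `H ≥ 1`, `β ≥ 1`, `x y`:
`|Cov₀(c_x, c_y) − Cov₀(|ℓ_x|², |ℓ_y|²)| ≤ C/β³`, where `c_x = chartPlaqCost H x 1 2` is the FULL plaquette cost in the chart. -/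
theorem gaussCov_chartPlaqCost_sub_linCurvSq_le : ∃ C : ℝ, ∀ H : ℕ, 1 ≤ H → ∀ β : ℝ, 1 ≤ β → ∀ x y : Site 4,
    |gaussCov β H (chartPlaqCost H x 1 2) (chartPlaqCost H y 1 2) - gaussCov β H (linCurvSq H (plaq12At x)) (linCurvSq H (plaq12At y))| ≤ C / β ^ 3 := by
  obtain ⟨C12, h12⟩ := plaquetteObsL2
  refine ⟨7 * C12, fun H hH β hβ1 x y => ?_⟩
  have hβ : 0 < β := by linarith
  obtain ⟨hLx, hOx, hRx⟩ := h12 H hH β hβ1 x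
  obtain ⟨hLy, hOy, hRy⟩ := h12 H hH β hβ1 y
  have hC12 : 0 ≤ C12 := by
    have h0 : 0 ≤ gaussAvg β H (fun a => linCurvSq H (plaq12At x) a ^ 2) := gaussAvg_nonneg H hβ fun a => sq_nonneg _
    have h1 : 0 ≤ C12 / β ^ 2 := h0.trans hLx
    have hb : 0 < β ^ 2 := by positivity
    by_contra hneg
    have : C12 / β ^ 2 < 0 := div_neg_of_neg_of_pos (not_le.1 hneg) hb
    linarith
  -- the letters
  set L : (LandauFree H → E3) → ℝ := linCurvSq H (plaq12At x) with hLdef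
  set L' : (LandauFree H → E3) → ℝ := linCurvSq H (plaq12At y) with hL'def
  set c : (LandauFree H → E3) → ℝ := chartPlaqCost H x 1 2 with hcdef
  set c' : (LandauFree H → E3) → ℝ := chartPlaqCost H y 1 2 with hc'def
  set O : (LandauFree H → E3) → ℝ := chartPlaqCostOdd H x 1 2 with hOdef
  set O' : (LandauFree H → E3) → ℝ := chartPlaqCostOdd H y 1 2 with hO'def
  let R : (LandauFree H → E3) → ℝ := fun a => c a - L a - O a
  let R' : (LandauFree H → E3) → ℝ := fun a => c' a - L' a - O' a
  let N : (LandauFree H → E3) → ℝ := fun a => c a - L a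
  let N' : (LandauFree H → E3) → ℝ := fun a => c' a - L' a
  let S : (LandauFree H → E3) → ℝ := fun a => ∑ i : Fin 4, ‖plaqVar H x 1 2 a i‖ ^ 2
  let S' : (LandauFree H → E3) → ℝ := fun a => ∑ i : Fin 4, ‖plaqVar H y 1 2 a i‖ ^ 2
  -- pointwise sizes
  have hS0 : ∀ a, 0 ≤ S a := fun a => Finset.sum_nonneg fun i _ => sq_nonneg _
  have hS'0 : ∀ a, 0 ≤ S' a := fun a => Finset.sum_nonneg fun i _ => sq_nonneg _
  have bL : ∀ a, |L a| ≤ 4 * S a := fun a => by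
    obtain ⟨h0, h4⟩ := linCurvSq_le_edgeSq H x a
    rw [abs_of_nonneg h0]; exact h4
  have bL' : ∀ a, |L' a| ≤ 4 * S' a := fun a => by
    obtain ⟨h0, h4⟩ := linCurvSq_le_edgeSq H y a
    rw [abs_of_nonneg h0]; exact h4
  have bc : ∀ a, |c a| ≤ 4 := fun a => PlaqObsL2.abs_chartPlaqCost_le H x 1 2 a
  have bc' : ∀ a, |c' a| ≤ 4 := fun a => PlaqObsL2.abs_chartPlaqCost_le H y 1 2 a
  have bO : ∀ a, |O a| ≤ 4 := fun a => PlaqObsL2.abs_chartPlaqCostOdd_le_four H x 1 2 a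
  have bO' : ∀ a, |O' a| ≤ 4 := fun a => PlaqObsL2.abs_chartPlaqCostOdd_le_four H y 1 2 a
  have bR : ∀ a, |R a| ≤ 8 + 4 * S a := fun a => by
    have h1 : |R a| ≤ |c a - L a| + |O a| := abs_sub _ _
    have h2 : |c a - L a| ≤ |c a| + |L a| := abs_sub _ _
    linarith [bc a, bL a, bO a]
  have bR' : ∀ a, |R' a| ≤ 8 + 4 * S' a := fun a => by
    have h1 : |R' a| ≤ |c' a - L' a| + |O' a| := abs_sub _ _
    have h2 : |c' a - L' a| ≤ |c' a| + |L' a| := abs_sub _ _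
    linarith [bc' a, bL' a, bO' a]
  have bN : ∀ a, |N a| ≤ 4 + 4 * S a := fun a => by
    have h2 : |c a - L a| ≤ |c a| + |L a| := abs_sub _ _
    linarith [bc a, bL a]
  have bN' : ∀ a, |N' a| ≤ 4 + 4 * S' a := fun a => by
    have h2 : |c' a - L' a| ≤ |c' a| + |L' a| := abs_sub _ _
    linarith [bc' a, bL' a]
  -- a universal integrable majorant
  let G : (LandauFree H → E3) → ℝ := fun a => 144 + 96 * S a + 96 * S' a + 16 * S a ^ 2 + 16 * S' a ^ 2
  have hGint : Integrable (fun a : LandauFree H → E3 => G a * gaussWeight β H a) := by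
    have h0 := (integrable_gaussWeight H hβ).const_mul (144 : ℝ)
    have h1 := (PlaqObsL2.integrable_edgeSq_pow_mul_gaussWeight H hβ x 1 2 1).const_mul (96 : ℝ)
    have h1' := (PlaqObsL2.integrable_edgeSq_pow_mul_gaussWeight H hβ y 1 2 1).const_mul (96 : ℝ)
    have h2 := (PlaqObsL2.integrable_edgeSq_pow_mul_gaussWeight H hβ x 1 2 2).const_mul (16 : ℝ)
    have h2' := (PlaqObsL2.integrable_edgeSq_pow_mul_gaussWeight H hβ y 1 2 2).const_mul (16 : ℝ)
    refine ((((h0.add h1).add h1').add h2).add h2').congr (Filter.Eventually.of_forall fun a => ?_)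
    simp only [Pi.add_apply, pow_one, G, S, S']
    ring
  -- measurability
  have mL : Measurable L := measurable_linCurvSq H _
  have mL' : Measurable L' := measurable_linCurvSq H _
  have mc : Measurable c := measurable_chartPlaqCost H x 1 2
  have mc' : Measurable c' := measurable_chartPlaqCost H y 1 2
  have mO : Measurable O := measurable_chartPlaqCostOdd H x 1 2
  have mO' : Measurable O' := measurable_chartPlaqCostOdd H y 1 2
  have mR : Measurable R := (mc.sub mL).sub mO
  have mR' : Measurable R' := (mc'.sub mL').sub mO'
  have mN : Measurable N := mc.sub mL
  have mN' : Measurable N' := mc'.sub mL'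
  have hInt : ∀ F : (LandauFree H → E3) → ℝ, Measurable F → (∀ a, |F a| ≤ G a) → Integrable (fun a => F a * gaussWeight β H a) :=
    fun F hF hle => integrable_mul_gaussWeight_of_abs_le H hβ hF hGint hle
  -- every needed observable is dominated by `G` (products of the size bounds)
  have key : ∀ a, ∀ u v : ℝ, |u| ≤ 4 + 4 * S a + (8 : ℝ) → |v| ≤ 4 + 4 * S' a + 8 → |u * v| ≤ G a := by
    intro a u v hu hv
    rw [abs_mul]
    have hu0 : 0 ≤ |u| := abs_nonneg _
    have hv0 : 0 ≤ |v| := abs_nonneg _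
    nlinarith [mul_le_mul hu hv hv0 (by linarith [hS0 a]), hS0 a, hS'0 a, sq_nonneg (S a - S' a)]
  have keyx : ∀ a, ∀ u v : ℝ, |u| ≤ 4 + 4 * S a + (8 : ℝ) → |v| ≤ 4 + 4 * S a + 8 → |u * v| ≤ G a := by
    intro a u v hu hv
    rw [abs_mul]
    have hu0 : 0 ≤ |u| := abs_nonneg _
    have hv0 : 0 ≤ |v| := abs_nonneg _
    nlinarith [mul_le_mul hu hv hv0 (by linarith [hS0 a]), hS0 a, hS'0 a]
  have keyy : ∀ a, ∀ u v : ℝ, |u| ≤ 4 + 4 * S' a + (8 : ℝ) → |v| ≤ 4 + 4 * S' a + 8 → |u * v| ≤ G a := by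
    intro a u v hu hv
    rw [abs_mul]
    have hu0 : 0 ≤ |u| := abs_nonneg _
    have hv0 : 0 ≤ |v| := abs_nonneg _
    nlinarith [mul_le_mul hu hv hv0 (by linarith [hS'0 a]), hS0 a, hS'0 a]
  have key1 : ∀ a, ∀ u : ℝ, |u| ≤ 4 + 4 * S a + (8 : ℝ) → |u| ≤ G a := by
    intro a u hu; nlinarith [hS0 a, hS'0 a, abs_nonneg u]
  have key1' : ∀ a, ∀ u : ℝ, |u| ≤ 4 + 4 * S' a + (8 : ℝ) → |u| ≤ G a := by
    intro a u hu; nlinarith [hS0 a, hS'0 a, abs_nonneg u]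
  -- size bounds in the common shape `≤ 4 + 4S + 8`
  have zL : ∀ a, |L a| ≤ 4 + 4 * S a + 8 := fun a => by linarith [bL a, hS0 a]
  have zL' : ∀ a, |L' a| ≤ 4 + 4 * S' a + 8 := fun a => by linarith [bL' a, hS'0 a]
  have zO : ∀ a, |O a| ≤ 4 + 4 * S a + 8 := fun a => by linarith [bO a, hS0 a]
  have zO' : ∀ a, |O' a| ≤ 4 + 4 * S' a + 8 := fun a => by linarith [bO' a, hS'0 a]
  have zR : ∀ a, |R a| ≤ 4 + 4 * S a + 8 := fun a => by linarith [bR a]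
  have zR' : ∀ a, |R' a| ≤ 4 + 4 * S' a + 8 := fun a => by linarith [bR' a]
  have zN : ∀ a, |N a| ≤ 4 + 4 * S a + 8 := fun a => by linarith [bN a]
  have zN' : ∀ a, |N' a| ≤ 4 + 4 * S' a + 8 := fun a => by linarith [bN' a]
  -- integrability of everything
  have iL := hInt L mL fun a => key1 a _ (zL a)
  have iN' := hInt N' mN' fun a => key1' a _ (zN' a)
  have iN := hInt N mN fun a => key1 a _ (zN a)
  have iL' := hInt L' mL' fun a => key1' a _ (zL' a)
  have iR := hInt R mR fun a => key1 a _ (zR a)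
  have iR' := hInt R' mR' fun a => key1' a _ (zR' a)
  have iO' := hInt O' mO' fun a => key1' a _ (zO' a)
  have iLN' := hInt (fun a => L a * N' a) (mL.mul mN') fun a => key a _ _ (zL a) (zN' a)
  have iNL' := hInt (fun a => N a * L' a) (mN.mul mL') fun a => key a _ _ (zN a) (zL' a)
  have iNN' := hInt (fun a => N a * N' a) (mN.mul mN') fun a => key a _ _ (zN a) (zN' a)
  have iLO' := hInt (fun a => L a * O' a) (mL.mul mO') fun a => key a _ _ (zL a) (zO' a)
  have iLR' := hInt (fun a => L a * R' a) (mL.mul mR') fun a => key a _ _ (zL a) (zR' a)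
  have iRL' := hInt (fun a => R a * L' a) (mR.mul mL') fun a => key a _ _ (zR a) (zL' a)
  have iOO' := hInt (fun a => O a * O' a) (mO.mul mO') fun a => key a _ _ (zO a) (zO' a)
  have iOR' := hInt (fun a => O a * R' a) (mO.mul mR') fun a => key a _ _ (zO a) (zR' a)
  have iRO' := hInt (fun a => R a * O' a) (mR.mul mO') fun a => key a _ _ (zR a) (zO' a)
  have iRR' := hInt (fun a => R a * R' a) (mR.mul mR') fun a => key a _ _ (zR a) (zR' a)
  have iL2 := hInt (fun a => L a ^ 2) (mL.pow_const 2) fun a => by rw [pow_two]; exact keyx a _ _ (zL a) (zL a)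
  have iL'2 := hInt (fun a => L' a ^ 2) (mL'.pow_const 2) fun a => by rw [pow_two]; exact keyy a _ _ (zL' a) (zL' a)
  have iR2 := hInt (fun a => R a ^ 2) (mR.pow_const 2) fun a => by rw [pow_two]; exact keyx a _ _ (zR a) (zR a)
  have iR'2 := hInt (fun a => R' a ^ 2) (mR'.pow_const 2) fun a => by rw [pow_two]; exact keyy a _ _ (zR' a) (zR' a)
  have iO2 := hInt (fun a => O a ^ 2) (mO.pow_const 2) fun a => by rw [pow_two]; exact keyx a _ _ (zO a) (zO a)
  have iO'2 := hInt (fun a => O' a ^ 2) (mO'.pow_const 2) fun a => by rw [pow_two]; exact keyy a _ _ (zO' a) (zO' a)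
  -- parity
  have pL : ∀ a, L (-a) = L a := fun a => linCurvSq_neg _ a
  have pO' : ∀ a, O' (-a) = -O' a := fun a => chartPlaqCostOdd_neg y 1 2 a
  have pO : ∀ a, O (-a) = -O a := fun a => chartPlaqCostOdd_neg x 1 2 a
  have pR : ∀ a, R (-a) = R a := by
    intro a
    have hc : c (-a) = c a - 2 * O a := by
      simp only [hcdef, hOdef, chartPlaqCostOdd]; ring
    simp only [R, hc, pL a, pO a]; ring
  have pR' : ∀ a, R' (-a) = R' a := by
    intro a
    have hL'neg : L' (-a) = L' a := linCurvSq_neg _ a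
    have hc : c' (-a) = c' a - 2 * O' a := by
      simp only [hc'def, hO'def, chartPlaqCostOdd]; ring
    simp only [R', hc, hL'neg, pO' a]; ring
  have eLO' : gaussAvg β H (fun a => L a * O' a) = 0 := gaussAvg_mul_eq_zero_of_even_odd β H pL pO'
  have eOR' : gaussAvg β H (fun a => O a * R' a) = 0 :=
    gaussAvg_eq_zero_of_odd β H fun a => by rw [pO a, pR' a, neg_mul]
  have eRO' : gaussAvg β H (fun a => R a * O' a) = 0 := gaussAvg_mul_eq_zero_of_even_odd β H pR pO'
  have eO : gaussAvg β H O = 0 := gaussAvg_eq_zero_of_odd β H pO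
  have eO' : gaussAvg β H O' = 0 := gaussAvg_eq_zero_of_odd β H pO'
  -- the algebra: Δ = Cov(L,N') + Cov(N,L') + Cov(N,N') and the parity reductions
  have hΔ : gaussCov β H c c' - gaussCov β H L L' =
      gaussCov β H L R' + gaussCov β H R L' + (gaussAvg β H (fun a => O a * O' a) + gaussCov β H R R') := by
    -- expectations of the pieces
    have hcN : ∀ a, c a = L a + N a := fun a => by simp only [N]; ring
    have hc'N : ∀ a, c' a = L' a + N' a := fun a => by simp only [N']; ring
    have hNR : ∀ a, N a = O a + R a := fun a => by simp only [N, R]; ring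
    have hN'R : ∀ a, N' a = O' a + R' a := fun a => by simp only [N', R']; ring
    have E_c : gaussAvg β H c = gaussAvg β H L + gaussAvg β H N := by
      rw [← gaussAvg_add _ _ iL iN]; exact congrArg _ (funext fun a => by simp only [N]; ring)
    have E_c' : gaussAvg β H c' = gaussAvg β H L' + gaussAvg β H N' := by
      rw [← gaussAvg_add _ _ iL' iN']; exact congrArg _ (funext fun a => by simp only [N']; ring)
    have E_N : gaussAvg β H N = gaussAvg β H R := by
      have h : gaussAvg β H N = gaussAvg β H O + gaussAvg β H R := by
        rw [← gaussAvg_add _ _ (hInt O mO fun a => key1 a _ (zO a)) iR]; exact congrArg _ (funext fun a => by simp only [N, R]; ring)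
      rw [h, eO, zero_add]
    have E_N' : gaussAvg β H N' = gaussAvg β H R' := by
      have h : gaussAvg β H N' = gaussAvg β H O' + gaussAvg β H R' := by
        rw [← gaussAvg_add _ _ iO' iR']; exact congrArg _ (funext fun a => by simp only [N', R']; ring)
      rw [h, eO', zero_add]
    have E_cc' : gaussAvg β H (fun a => c a * c' a) =
        gaussAvg β H (fun a => L a * L' a) + gaussAvg β H (fun a => L a * N' a) + gaussAvg β H (fun a => N a * L' a) +
          gaussAvg β H (fun a => N a * N' a) := by
      have iLL' := hInt (fun a => L a * L' a) (mL.mul mL') fun a => key a _ _ (zL a) (zL' a)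
      have h12 : Integrable (fun a : LandauFree H → E3 => (L a * L' a + L a * N' a) * gaussWeight β H a) :=
        (iLL'.add iLN').congr (Filter.Eventually.of_forall fun a => by simp only [Pi.add_apply]; ring)
      have h123 : Integrable (fun a : LandauFree H → E3 => (L a * L' a + L a * N' a + N a * L' a) * gaussWeight β H a) :=
        ((iLL'.add iLN').add iNL').congr (Filter.Eventually.of_forall fun a => by simp only [Pi.add_apply]; ring)
      rw [← gaussAvg_add _ _ iLL' iLN', ← gaussAvg_add _ _ h12 iNL', ← gaussAvg_add _ _ h123 iNN']
      exact congrArg _ (funext fun a => by simp only [N, N']; ring)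
    have E_LN' : gaussAvg β H (fun a => L a * N' a) = gaussAvg β H (fun a => L a * R' a) := by
      have h : gaussAvg β H (fun a => L a * N' a) = gaussAvg β H (fun a => L a * O' a) + gaussAvg β H (fun a => L a * R' a) := by
        rw [← gaussAvg_add _ _ iLO' iLR']; exact congrArg _ (funext fun a => by simp only [N', R']; ring)
      rw [h, eLO', zero_add]
    have E_NL' : gaussAvg β H (fun a => N a * L' a) = gaussAvg β H (fun a => R a * L' a) := by
      have iOL' := hInt (fun a => O a * L' a) (mO.mul mL') fun a => key a _ _ (zO a) (zL' a)
      have eOL' : gaussAvg β H (fun a => O a * L' a) = 0 :=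
        gaussAvg_eq_zero_of_odd β H fun a => by rw [pO a, show L' (-a) = L' a from linCurvSq_neg _ a, neg_mul]
      have h : gaussAvg β H (fun a => N a * L' a) = gaussAvg β H (fun a => O a * L' a) + gaussAvg β H (fun a => R a * L' a) := by
        rw [← gaussAvg_add _ _ iOL' iRL']; exact congrArg _ (funext fun a => by simp only [N, R]; ring)
      rw [h, eOL', zero_add]
    have E_NN' : gaussAvg β H (fun a => N a * N' a) = gaussAvg β H (fun a => O a * O' a) + gaussAvg β H (fun a => R a * R' a) := by
      have h : gaussAvg β H (fun a => N a * N' a) = gaussAvg β H (fun a => O a * O' a) + gaussAvg β H (fun a => O a * R' a) +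
          gaussAvg β H (fun a => R a * O' a) + gaussAvg β H (fun a => R a * R' a) := by
        have h2 : Integrable (fun a : LandauFree H → E3 => (O a * O' a + O a * R' a) * gaussWeight β H a) :=
          (iOO'.add iOR').congr (Filter.Eventually.of_forall fun a => by simp only [Pi.add_apply]; ring)
        have h3 : Integrable (fun a : LandauFree H → E3 => (O a * O' a + O a * R' a + R a * O' a) * gaussWeight β H a) :=
          ((iOO'.add iOR').add iRO').congr (Filter.Eventually.of_forall fun a => by simp only [Pi.add_apply]; ring)
        rw [← gaussAvg_add _ _ iOO' iOR', ← gaussAvg_add _ _ h2 iRO', ← gaussAvg_add _ _ h3 iRR']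
        exact congrArg _ (funext fun a => by simp only [N, N', R, R']; ring)
      rw [h, eOR', eRO', add_zero, add_zero]
    unfold gaussCov
    rw [E_cc', E_c, E_c', E_N, E_N', E_LN', E_NL', E_NN']
    ring
  -- Cauchy–Schwarz on each term
  have sq1 : Real.sqrt (C12 / β ^ 2) * Real.sqrt (C12 / β ^ 4) = C12 / β ^ 3 := by
    rw [← Real.sqrt_mul (by positivity)]
    rw [show C12 / β ^ 2 * (C12 / β ^ 4) = (C12 / β ^ 3) ^ 2 by field_simp]
    exact Real.sqrt_sq (by positivity)
  have sq2 : Real.sqrt (C12 / β ^ 3) * Real.sqrt (C12 / β ^ 3) = C12 / β ^ 3 := Real.mul_self_sqrt (by positivity)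
  have sq3 : Real.sqrt (C12 / β ^ 4) * Real.sqrt (C12 / β ^ 4) = C12 / β ^ 4 := Real.mul_self_sqrt (by positivity)
  have t1 : |gaussCov β H L R'| ≤ 2 * (C12 / β ^ 3) := by
    refine (abs_gaussCov_le H hβ iL iR' iL2 iR'2 iLR').trans ?_
    rw [← sq1]
    exact mul_le_mul_of_nonneg_left (mul_le_mul (Real.sqrt_le_sqrt hLx) (Real.sqrt_le_sqrt hRy) (Real.sqrt_nonneg _) (Real.sqrt_nonneg _)) (by norm_num)
  have t2 : |gaussCov β H R L'| ≤ 2 * (C12 / β ^ 3) := by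
    refine (abs_gaussCov_le H hβ iR iL' iR2 iL'2 iRL').trans ?_
    rw [← sq1, mul_comm (Real.sqrt (C12 / β ^ 2))]
    exact mul_le_mul_of_nonneg_left (mul_le_mul (Real.sqrt_le_sqrt hRx) (Real.sqrt_le_sqrt hLy) (Real.sqrt_nonneg _) (Real.sqrt_nonneg _)) (by norm_num)
  have t3 : |gaussAvg β H (fun a => O a * O' a)| ≤ C12 / β ^ 3 := by
    refine (abs_gaussAvg_mul_le_sqrt H hβ iO2 iO'2 iOO').trans ?_
    rw [← sq2]
    exact mul_le_mul (Real.sqrt_le_sqrt hOx) (Real.sqrt_le_sqrt hOy) (Real.sqrt_nonneg _) (Real.sqrt_nonneg _)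
  have t4 : |gaussCov β H R R'| ≤ 2 * (C12 / β ^ 4) := by
    refine (abs_gaussCov_le H hβ iR iR' iR2 iR'2 iRR').trans ?_
    rw [← sq3]
    exact mul_le_mul_of_nonneg_left (mul_le_mul (Real.sqrt_le_sqrt hRx) (Real.sqrt_le_sqrt hRy) (Real.sqrt_nonneg _) (Real.sqrt_nonneg _)) (by norm_num)
  have h34 : C12 / β ^ 4 ≤ C12 / β ^ 3 := by
    refine div_le_div_of_nonneg_left hC12 (by positivity) ?_
    exact pow_le_pow_right₀ hβ1 (by norm_num)
  rw [hΔ]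
  calc |gaussCov β H L R' + gaussCov β H R L' + (gaussAvg β H (fun a => O a * O' a) + gaussCov β H R R')|
      ≤ |gaussCov β H L R'| + |gaussCov β H R L'| + (|gaussAvg β H (fun a => O a * O' a)| + |gaussCov β H R R'|) := by
        refine (abs_add_le _ _).trans (add_le_add (abs_add_le _ _) (abs_add_le _ _))
    _ ≤ 2 * (C12 / β ^ 3) + 2 * (C12 / β ^ 3) + (C12 / β ^ 3 + 2 * (C12 / β ^ 3)) := by linarith
    _ = 7 * C12 / β ^ 3 := by ring

end EdgeChartGaussian

end Summit.QuantumFields.YangMills.Theorems.AllWindowsColdBoxBoxHighLine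

end
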